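import Literature.Analysis.FluidPDE.PeriodicCylinderSymmetry
import HarnessLib

/-!
# Covariance of the Helmholtz decomposition and of the weak periodic Neumann problem under the
symmetries of the cylinder

Topic `Literature/Analysis/FluidPDE`. Theorem-only file (no definitions, no named facts) of the
regularity theory for the periodic Neumann problem on the cylinder `{r ≤ 1} × ℝ/Lℤ`
(`PeriodicCylinderHelmholtz.lean`, `PeriodicCylinderSymmetry.lean`), the analytic input of the local
existence theorem for the Euler equations in the periodic cylinder (T. Kato, C. Y. Lai, J. Funct.
Anal. **56** (1984), Thm I/II; the tree's named fact
`Literature.Analysis.FluidPDE.KatoLai1984_periodicCylinderUniformExistence`). Nirenberg's difference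
quotients along the symmetries of the domain (CPAM 8 (1955); Kato–Lai's [11]) rest on one fact: **a
symmetry of the problem maps solutions to solutions.** This file proves it for the weak Neumann
problem of `PeriodicCylinderHelmholtz.lean` and the two symmetry groups of
`PeriodicCylinderSymmetry.lean` (periodic axial shifts `U_a`, rotations `R_θ` about the axis):

* chain rules within the closed cylinder: `∇_K q(· + a e_z) = (∇_K q)(· + a e_z)`,
  `∇_K (q ∘ R_θ) = R_{−θ} (∇_K q) ∘ R_θ` (`cylGrad_comp_add_smul_eZ`, `cylGrad_comp_rotZ`), whence the
  actions map smooth gradients to smooth gradients (`axialShiftLp_toCell_cylGrad`,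
  `rotFieldLp_toCell_cylGrad`) and **preserve the gradient space `𝓖`** (`axialShiftLp_mem_gradSpace`,
  `rotFieldLp_mem_gradSpace`; a continuous linear map preserving a submodule preserves its closure,
  `mem_topologicalClosure_map_of_forall_mem`, Mathlib's `Submodule.topologicalClosure_mem_invtSubmodule`);
* group laws and **adjoint relations** `⟪U_a f, g⟫ = ⟪f, U_{−a} g⟫`, `⟪R_θ v, w⟫ = ⟪v, R_{−θ} w⟫`
  (`inner_axialShiftLp_left`, `inner_rotFieldLp_left`, `inner_rotLp_left`);
* **invariance of the potential graph** (mean zero is kept because cell integrals of periodic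
  functions are shift and rotation invariant) and **covariance of the potential**,
  `pot(U_a G) = U_a pot G`, `pot(R_θ G) = R_θ pot G` (`potential_axialShiftLp`, `potential_rotFieldLp`);
* **covariance of the weak Neumann solution** (`coe_neumannGrad_map_eq`, abstract: actions with the
  adjoint relations which preserve `𝓖` and intertwine the potential commute with the Riesz solution
  map; instances `coe_neumannGrad_axialShiftLp`, `coe_neumannGrad_rotFieldLp`):
  `∇q[h₀(·+ae_z), h₁(·+ae_z)] = ∇q[h₀,h₁](·+ae_z)` and `∇q[h₀∘R_θ, R_{−θ}h₁∘R_θ] = R_{−θ}∇q[h₀,h₁]∘R_θ`;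
  in particular the **Helmholtz and Leray projections commute with the symmetries**
  (`helmholtzProj_axialShiftLp`, `lerayProj_axialShiftLp`, `helmholtzProj_rotFieldLp`,
  `lerayProj_rotFieldLp`) — the form in which Kato–Lai's `P` inherits the symmetries of the domain.

Mathlib/tree search: everything rests on the two preceding files and on `fderivWithin_comp_add_right`,
`axialShift_vadd_closure_unitCylinder` (`PeriodicCylinderGagliardoNirenberg`),
`ContinuousLinearEquiv.comp_right_fderivWithin`, `uniqueDiffOn_K`, `rotZLIE`,
`LinearIsometry.inner_map_map`, `image_closure_subset_closure_image`, `ContinuousLinearMap.prodMap`;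
no covariance statement for a Neumann/Helmholtz problem existed in the tree (`lean search
'helmholtz|lerayProj|neumannGrad'`: only `PeriodicCylinderHelmholtz`).

## References

* L. Nirenberg, Comm. Pure Appl. Math. 8 (1955) 649–675 (difference quotients along symmetries).
  [folklore]
* T. Kato, C. Y. Lai, J. Funct. Anal. 56 (1984) 15–28, §4 (i), §5 (`P` on the domain). [KatoLai1984]
-/

noncomputable section

open MeasureTheory Set Function Filter Topology TopologicalSpace WithLp Metric
open scoped ContDiff NNReal ENNReal InnerProductSpace RealInnerProductSpace

namespace Literature.Analysis.FluidPDE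

open Literature.Analysis.FunctionSpaces

/-- Local notation for physical space `ℝ³ = EuclideanSpace ℝ (Fin 3)`. -/
local notation "ℝ³" => EuclideanSpace ℝ (Fin 3)

/-- Local notation for the closed unit cylinder `{r ≤ 1}`. -/
local notation "𝕂" => closure (SetLike.coe unitCylinder : Set (EuclideanSpace ℝ (Fin 3)))

namespace PeriodicCylinder

variable {L : ℝ}

/-! ### Gradients within the closed cylinder of translated and rotated functions -/

/-- `∇_K (q(· + a e_z)) = (∇_K q)(· + a e_z)` (the closed cylinder is invariant under axial
translations). [folklore] -/
theorem cylGrad_comp_add_smul_eZ (q : ℝ³ → ℝ) (a : ℝ) (x : ℝ³) :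
    cylGrad (fun y => q (y + a • eZ)) x = cylGrad q (x + a • eZ) := by
  have hfd : fderivWithin ℝ (fun y => q (y + a • eZ)) 𝕂 x = fderivWithin ℝ q 𝕂 (x + a • eZ) := by
    rw [fderivWithin_comp_add_right, eZ_eq_single, axialShift_vadd_closure_unitCylinder]
  ext i
  rw [← inner_cylBasis_left i, ← inner_cylBasis_left i, real_inner_comm, inner_cylGrad_left,
    real_inner_comm, inner_cylGrad_left, hfd]

/-- The closed cylinder is invariant under the rotations about the axis (preimage form). [folklore] -/
theorem rotZ_preimage_closure_unitCylinder (θ : ℝ) : rotZ θ ⁻¹' (𝕂 : Set ℝ³) = 𝕂 := by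
  ext x
  exact rotZ_mem_closure_unitCylinder_iff θ

/-- `⟪w, R_θ v⟫ = ⟪R_{−θ} w, v⟫` — a file-local copy of `Literature.Analysis.FluidPDE.inner_rotZ_right`
(`SlipCylinderClassicalNS.lean`, far downstream of this file and not importable here). [folklore] -/
private theorem inner_rotZ_right' (θ : ℝ) (w v : ℝ³) : ⟪w, rotZ θ v⟫ = ⟪rotZ (-θ) w, v⟫ := by
  have h := (rotZLIE θ).inner_map_map (rotZ (-θ) w) v
  simp only [rotZLIE_apply, ← rotZ_add, add_neg_cancel, rotZ_zero] at h
  exact h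

/-- **`∇_K (q ∘ R_θ)(x) = R_{−θ} (∇_K q)(R_θ x)`** on the closed cylinder (chain rule within the
`R_θ`-invariant closed cylinder, `R_θ` an isometry). [folklore] -/
theorem cylGrad_comp_rotZ {q : ℝ³ → ℝ} (θ : ℝ) {x : ℝ³} (hx : x ∈ 𝕂) :
    cylGrad (fun y => q (rotZ θ y)) x = rotZ (-θ) (cylGrad q (rotZ θ x)) := by
  have hiso : fderivWithin ℝ (q ∘ (rotZLIE θ).toContinuousLinearEquiv)
      ((rotZLIE θ).toContinuousLinearEquiv ⁻¹' 𝕂) x =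
      (fderivWithin ℝ q 𝕂 ((rotZLIE θ).toContinuousLinearEquiv x)).comp
        ((rotZLIE θ).toContinuousLinearEquiv : ℝ³ →L[ℝ] ℝ³) := by
    refine (rotZLIE θ).toContinuousLinearEquiv.comp_right_fderivWithin ?_
    have hpre : (rotZLIE θ).toContinuousLinearEquiv ⁻¹' (𝕂 : Set ℝ³) = 𝕂 :=
      rotZ_preimage_closure_unitCylinder θ
    rw [hpre]
    exact uniqueDiffOn_K x hx
  have hpre : (rotZLIE θ).toContinuousLinearEquiv ⁻¹' (𝕂 : Set ℝ³) = 𝕂 :=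
    rotZ_preimage_closure_unitCylinder θ
  rw [hpre] at hiso
  have hfd : ∀ v, fderivWithin ℝ (fun y => q (rotZ θ y)) 𝕂 x v = fderivWithin ℝ q 𝕂 (rotZ θ x) (rotZ θ v) :=
    fun v => by
    have := congrArg (fun T : ℝ³ →L[ℝ] ℝ => T v) hiso
    simpa [Function.comp_def] using this
  ext i
  rw [← inner_cylBasis_left i, ← inner_cylBasis_left i, real_inner_comm, inner_cylGrad_left, hfd,
    ← inner_cylGrad_left, inner_rotZ_right', real_inner_comm]

/-! ### Invariance of the smooth gradients and of the gradient space -/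

/-- **The periodic shift maps smooth gradients to smooth gradients**: `U_a [∇q] = [∇ q(· + a e_z)]`.
[folklore] -/
theorem axialShiftLp_toCell_cylGrad (hL : 0 < L) (a : ℝ) {q : ℝ³ → ℝ} (hq : IsSmoothPeriodic L q) :
    axialShiftLp L a (toCell L (cylGrad q)) = toCell L (cylGrad fun y => q (y + a • eZ)) := by
  rw [axialShiftLp_toCell hL a hq.cylGrad.periodic hq.cylGrad.memLp]
  exact toCell_congr fun x _ => (cylGrad_comp_add_smul_eZ q a x).symm

/-- **The rotations map smooth gradients to smooth gradients**: `R_θ [∇q] = [∇ (q ∘ R_θ)]`. [folklore] -/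
theorem rotFieldLp_toCell_cylGrad (θ : ℝ) {q : ℝ³ → ℝ} (hq : IsSmoothPeriodic L q) :
    rotFieldLp L θ (toCell L (cylGrad q)) = toCell L (cylGrad fun y => q (rotZ θ y)) := by
  rw [rotFieldLp_toCell θ hq.cylGrad.memLp]
  exact toCell_congr fun x hx => (cylGrad_comp_rotZ θ (cell_subset_K hx)).symm

/-- The shift preserves the smooth gradients. [folklore] -/
theorem axialShiftLp_mem_gradRange (hL : 0 < L) (a : ℝ) {G : Lp ℝ³ 2 (cellMeasure L)}
    (hG : G ∈ gradRange L) : (axialShiftLp L a G : Lp ℝ³ 2 (cellMeasure L)) ∈ gradRange L := by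
  obtain ⟨q, hq, rfl⟩ := hG
  rw [axialShiftLp_toCell_cylGrad hL a hq]
  exact toCell_cylGrad_mem_gradRange (hq.comp_add_smul_eZ a)

/-- The rotations preserve the smooth gradients. [folklore] -/
theorem rotFieldLp_mem_gradRange (θ : ℝ) {G : Lp ℝ³ 2 (cellMeasure L)} (hG : G ∈ gradRange L) :
    (rotFieldLp L θ G : Lp ℝ³ 2 (cellMeasure L)) ∈ gradRange L := by
  obtain ⟨q, hq, rfl⟩ := hG
  rw [rotFieldLp_toCell_cylGrad θ hq]
  exact toCell_cylGrad_mem_gradRange (hq.comp_rotZ θ)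

/-- A continuous linear map which preserves a submodule preserves its closure (Mathlib's
`Submodule.topologicalClosure_mem_invtSubmodule`, unfolded to membership form). [folklore] -/
theorem mem_topologicalClosure_map_of_forall_mem {𝕜 V : Type*} [Semiring 𝕜] [AddCommMonoid V]
    [Module 𝕜 V] [TopologicalSpace V] [ContinuousAdd V] [TopologicalSpace 𝕜] [ContinuousSMul 𝕜 V]
    (T : V →L[𝕜] V) (K : Submodule 𝕜 V) (hT : ∀ x ∈ K, T x ∈ K) {x : V} (hx : x ∈ K.topologicalClosure) :
    T x ∈ K.topologicalClosure := by
  have hs : K ∈ Module.End.invtSubmodule (T : V →ₗ[𝕜] V) := fun y hy => hT y hy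
  exact Submodule.topologicalClosure_mem_invtSubmodule hs hx

/-- **The periodic shift preserves the gradient space `𝓖`.** [folklore] -/
theorem axialShiftLp_mem_gradSpace (hL : 0 < L) (a : ℝ) {G : Lp ℝ³ 2 (cellMeasure L)}
    (hG : G ∈ gradSpace L) : (axialShiftLp L a G : Lp ℝ³ 2 (cellMeasure L)) ∈ gradSpace L :=
  mem_topologicalClosure_map_of_forall_mem (axialShiftLp L a).toContinuousLinearMap (gradRange L)
    (fun _ hx => axialShiftLp_mem_gradRange hL a hx) hG

/-- **The rotations preserve the gradient space `𝓖`.** [folklore] -/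
theorem rotFieldLp_mem_gradSpace (θ : ℝ) {G : Lp ℝ³ 2 (cellMeasure L)} (hG : G ∈ gradSpace L) :
    (rotFieldLp L θ G : Lp ℝ³ 2 (cellMeasure L)) ∈ gradSpace L :=
  mem_topologicalClosure_map_of_forall_mem (rotFieldLp L θ).toContinuousLinearMap (gradRange L)
    (fun _ hx => rotFieldLp_mem_gradRange θ hx) hG

/-! ### Group laws -/

/-- `τ_a ∘ τ_b = τ_{b + a}`. [folklore] -/
theorem cellShift_cellShift (hL : 0 < L) (a b : ℝ) (x : ℝ³) :
    cellShift L a (cellShift L b x) = cellShift L (b + a) x := by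
  simp only [cellShift_apply]
  rw [add_smul, ← add_assoc]
  -- `axialRed (axialRed y + a e_z) = axialRed (y + a e_z)` : both sides differ from `y + a e_z` by a period
  set y : ℝ³ := x + b • eZ with hy
  have h1 : axialRed L y + a • eZ = (y + a • eZ) + (((-⌊y 2 / L⌋ : ℤ) : ℝ) * L) • eZ := by
    simp only [axialRed, Int.cast_neg, neg_mul, neg_smul]
    abel
  rw [h1]
  exact (isAxiallyPeriodic_axialRed hL).add_int_mul_smul_eZ (-⌊y 2 / L⌋) (y + a • eZ)

/-- **Group law of the shift action**: `U_a (U_b f) = U_{a+b} f`. [folklore] -/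
theorem axialShiftLp_axialShiftLp {E : Type*} [NormedAddCommGroup E] [NormedSpace ℝ E] (hL : 0 < L)
    (a b : ℝ) (f : Lp E 2 (cellMeasure L)) :
    axialShiftLp L a (axialShiftLp L b f) = axialShiftLp L (a + b) f := by
  refine Lp.ext_iff.2 ?_
  filter_upwards [coeFn_axialShiftLp hL a (axialShiftLp L b f), coeFn_axialShiftLp hL (a + b) f,
    (measurePreserving_cellShift hL a).quasiMeasurePreserving.ae_eq (coeFn_axialShiftLp hL b f)]
    with x h1 h2 h3
  simp only [Function.comp_apply] at h3
  rw [h1, h3, h2, cellShift_cellShift hL b a]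

/-- `U_0 = 1`. [folklore] -/
theorem axialShiftLp_zero {E : Type*} [NormedAddCommGroup E] [NormedSpace ℝ E] (hL : 0 < L)
    (f : Lp E 2 (cellMeasure L)) : axialShiftLp L 0 f = f := by
  refine Lp.ext_iff.2 ?_
  filter_upwards [coeFn_axialShiftLp hL 0 f, ae_restrict_mem (cylinderCell L).isOpen.measurableSet]
    with x h1 hx
  rw [h1, cellShift_apply, zero_smul, add_zero, axialRed_eq_self_of_mem_cell hL hx]

/-- `U_{−a} U_a = 1`. [folklore] -/
theorem axialShiftLp_neg_axialShiftLp {E : Type*} [NormedAddCommGroup E] [NormedSpace ℝ E] (hL : 0 < L)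
    (a : ℝ) (f : Lp E 2 (cellMeasure L)) : axialShiftLp L (-a) (axialShiftLp L a f) = f := by
  rw [axialShiftLp_axialShiftLp hL, neg_add_cancel, axialShiftLp_zero hL]

/-- **Group law of the rotation action on fields**: `R_θ (R_θ' v) = R_{θ'+θ} v`. [folklore] -/
theorem rotFieldLp_rotFieldLp (θ θ' : ℝ) (v : Lp ℝ³ 2 (cellMeasure L)) :
    rotFieldLp L θ (rotFieldLp L θ' v) = rotFieldLp L (θ' + θ) v := by
  refine Lp.ext_iff.2 ?_
  filter_upwards [coeFn_rotFieldLp θ (rotFieldLp L θ' v), coeFn_rotFieldLp (θ' + θ) v,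
    (measurePreserving_rotZ_cell (L := L) θ).quasiMeasurePreserving.ae_eq (coeFn_rotFieldLp θ' v)]
    with x h1 h2 h3
  simp only [Function.comp_apply] at h3
  rw [h1, h3, h2, ← rotZ_add, ← rotZ_add, neg_add, add_comm θ' θ, add_comm (-θ') (-θ)]

/-- `R_0 = 1` on fields. [folklore] -/
theorem rotFieldLp_zero (v : Lp ℝ³ 2 (cellMeasure L)) : rotFieldLp L 0 v = v := by
  refine Lp.ext_iff.2 ?_
  filter_upwards [coeFn_rotFieldLp 0 v] with x h1
  rw [h1, neg_zero, rotZ_zero, rotZ_zero]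

/-- `R_{−θ} R_θ = 1` on fields. [folklore] -/
theorem rotFieldLp_neg_rotFieldLp (θ : ℝ) (v : Lp ℝ³ 2 (cellMeasure L)) :
    rotFieldLp L (-θ) (rotFieldLp L θ v) = v := by
  rw [rotFieldLp_rotFieldLp, add_neg_cancel, rotFieldLp_zero]

/-- **Group law of the rotation action on scalars**: `R_θ (R_θ' f) = R_{θ'+θ} f`. [folklore] -/
theorem rotLp_rotLp {E : Type*} [NormedAddCommGroup E] [NormedSpace ℝ E] (θ θ' : ℝ)
    (f : Lp E 2 (cellMeasure L)) : rotLp L θ (rotLp L θ' f) = rotLp L (θ' + θ) f := by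
  refine Lp.ext_iff.2 ?_
  filter_upwards [coeFn_rotLp θ (rotLp L θ' f), coeFn_rotLp (θ' + θ) f,
    (measurePreserving_rotZ_cell (L := L) θ).quasiMeasurePreserving.ae_eq (coeFn_rotLp θ' f)]
    with x h1 h2 h3
  simp only [Function.comp_apply] at h3
  rw [h1, h3, h2, ← rotZ_add]

/-- `R_0 = 1` on scalars. [folklore] -/
theorem rotLp_zero {E : Type*} [NormedAddCommGroup E] [NormedSpace ℝ E] (f : Lp E 2 (cellMeasure L)) :
    rotLp L 0 f = f := by
  refine Lp.ext_iff.2 ?_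
  filter_upwards [coeFn_rotLp 0 f] with x h1
  rw [h1, rotZ_zero]

/-- `R_{−θ} R_θ = 1` on scalars. [folklore] -/
theorem rotLp_neg_rotLp {E : Type*} [NormedAddCommGroup E] [NormedSpace ℝ E] (θ : ℝ)
    (f : Lp E 2 (cellMeasure L)) : rotLp L (-θ) (rotLp L θ f) = f := by
  rw [rotLp_rotLp, add_neg_cancel, rotLp_zero]

/-! ### Adjoint relations -/

/-- `⟪U_a f, g⟫ = ⟪f, U_{−a} g⟫`. [folklore] -/
theorem inner_axialShiftLp_left {E : Type*} [NormedAddCommGroup E] [InnerProductSpace ℝ E] (hL : 0 < L)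
    (a : ℝ) (f g : Lp E 2 (cellMeasure L)) : ⟪axialShiftLp L a f, g⟫ = ⟪f, axialShiftLp L (-a) g⟫ := by
  conv_lhs => rw [← axialShiftLp_neg_axialShiftLp hL (-a) g, neg_neg]
  exact (axialShiftLp L a).inner_map_map f _

/-- `⟪R_θ v, w⟫ = ⟪v, R_{−θ} w⟫` on fields. [folklore] -/
theorem inner_rotFieldLp_left (θ : ℝ) (v w : Lp ℝ³ 2 (cellMeasure L)) :
    ⟪rotFieldLp L θ v, w⟫ = ⟪v, rotFieldLp L (-θ) w⟫ := by
  conv_lhs => rw [← rotFieldLp_neg_rotFieldLp (-θ) w, neg_neg]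
  exact (rotFieldLp L θ).inner_map_map v _

/-- `⟪R_θ f, g⟫ = ⟪f, R_{−θ} g⟫` on scalars. [folklore] -/
theorem inner_rotLp_left {E : Type*} [NormedAddCommGroup E] [InnerProductSpace ℝ E] (θ : ℝ)
    (f g : Lp E 2 (cellMeasure L)) : ⟪rotLp L θ f, g⟫ = ⟪f, rotLp L (-θ) g⟫ := by
  conv_lhs => rw [← rotLp_neg_rotLp (-θ) g, neg_neg]
  exact (rotLp L θ).inner_map_map f _

/-! ### Invariance of the potential graph; covariance of the potential -/

/-- **The periodic shift preserves the potential graph** (mean zero is preserved by the shift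
invariance of cell integrals). [folklore] -/
theorem prod_mem_potentialGraph_of_shift (hL : 0 < L) (a : ℝ)
    {z : Lp ℝ 2 (cellMeasure L) × Lp ℝ³ 2 (cellMeasure L)} (hz : z ∈ potentialGraph L) :
    (axialShiftLp L a z.1, axialShiftLp L a z.2) ∈ potentialGraph L := by
  obtain ⟨q, hq, h0, rfl⟩ := hz
  refine ⟨fun y => q (y + a • eZ), hq.comp_add_smul_eZ a, ?_, ?_⟩
  · rw [integral_comp_add_smul_eZ hL a hq.periodic hq.memLp.aestronglyMeasurable, h0]
  · simp only
    rw [axialShiftLp_toCell hL a hq.periodic hq.memLp, axialShiftLp_toCell_cylGrad hL a hq]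

/-- **The rotations preserve the potential graph.** [folklore] -/
theorem prod_mem_potentialGraph_of_rot (θ : ℝ)
    {z : Lp ℝ 2 (cellMeasure L) × Lp ℝ³ 2 (cellMeasure L)} (hz : z ∈ potentialGraph L) :
    (rotLp L θ z.1, rotFieldLp L θ z.2) ∈ potentialGraph L := by
  obtain ⟨q, hq, h0, rfl⟩ := hz
  refine ⟨fun y => q (rotZ θ y), hq.comp_rotZ θ, ?_, ?_⟩
  · rw [integral_comp_rotZ_cell θ hq.memLp.aestronglyMeasurable, h0]
  · simp only
    rw [rotLp_toCell θ hq.memLp, rotFieldLp_toCell_cylGrad θ hq]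

/-- A pair of continuous linear maps preserving the potential graph preserves its closure. [folklore] -/
theorem prod_mem_potentialGraphClosure_of_clm (S : Lp ℝ 2 (cellMeasure L) →L[ℝ] Lp ℝ 2 (cellMeasure L))
    (T : Lp ℝ³ 2 (cellMeasure L) →L[ℝ] Lp ℝ³ 2 (cellMeasure L))
    (hST : ∀ z ∈ potentialGraph L, (S z.1, T z.2) ∈ potentialGraph L)
    {z : Lp ℝ 2 (cellMeasure L) × Lp ℝ³ 2 (cellMeasure L)} (hz : z ∈ potentialGraphClosure L) :
    (S z.1, T z.2) ∈ potentialGraphClosure L := by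
  have h := mem_topologicalClosure_map_of_forall_mem (S.prodMap T) (potentialGraph L)
    (fun w hw => hST w hw) (x := z) hz
  exact h

/-- **Covariance of the potential under the shift**: `pot(U_a G) = U_a pot(G)`. [folklore] -/
theorem potential_axialShiftLp (hL : 0 < L) (a : ℝ) (G : gradSpace L) :
    potential ⟨axialShiftLp L a (G : Lp ℝ³ 2 (cellMeasure L)), axialShiftLp_mem_gradSpace hL a G.2⟩ =
      axialShiftLp L a (potential G) := by
  refine potential_eq_of_mem hL _ ?_
  exact prod_mem_potentialGraphClosure_of_clm (axialShiftLp L a).toContinuousLinearMap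
    (axialShiftLp L a).toContinuousLinearMap (fun z hz => prod_mem_potentialGraph_of_shift hL a hz)
    (potential_mem hL G)

/-- **Covariance of the potential under the rotations**: `pot(R_θ G) = R_θ pot(G)`. [folklore] -/
theorem potential_rotFieldLp (hL : 0 < L) (θ : ℝ) (G : gradSpace L) :
    potential ⟨rotFieldLp L θ (G : Lp ℝ³ 2 (cellMeasure L)), rotFieldLp_mem_gradSpace θ G.2⟩ =
      rotLp L θ (potential G) := by
  refine potential_eq_of_mem hL _ ?_
  exact prod_mem_potentialGraphClosure_of_clm (rotLp L θ).toContinuousLinearMap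
    (rotFieldLp L θ).toContinuousLinearMap (fun z hz => prod_mem_potentialGraph_of_rot θ hz)
    (potential_mem hL G)

/-! ### Covariance of the weak Neumann problem -/

/-- **Abstract covariance of the weak Neumann solution.** Let `U_s, U_s'` act on `L²(cell)` and
`U_v, U_v'` on `L²(cell; ℝ³)`, continuously and linearly, with the adjoint relations
`⟪U_v f, g⟫ = ⟪f, U_v' g⟫`, `⟪U_s f, g⟫ = ⟪f, U_s' g⟫`, such that `U_v, U_v'` preserve `𝓖` and
`pot ∘ U_v' = U_s' ∘ pot` on `𝓖`. Then `∇q[U_s h₀, U_v h₁] = U_v ∇q[h₀, h₁]` — test the defining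
identity against `Ψ ∈ 𝓖` and move the action onto `Ψ`. [folklore] -/
theorem coe_neumannGrad_map_eq {Us Us' : Lp ℝ 2 (cellMeasure L) →L[ℝ] Lp ℝ 2 (cellMeasure L)}
    {Uv Uv' : Lp ℝ³ 2 (cellMeasure L) →L[ℝ] Lp ℝ³ 2 (cellMeasure L)}
    (hadjv : ∀ f g, ⟪Uv f, g⟫ = ⟪f, Uv' g⟫) (hadjs : ∀ f g, ⟪Us f, g⟫ = ⟪f, Us' g⟫)
    (hUv : ∀ G ∈ gradSpace L, Uv G ∈ gradSpace L) (hUv' : ∀ G ∈ gradSpace L, Uv' G ∈ gradSpace L)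
    (hpot' : ∀ G : gradSpace L, potential ⟨Uv' G, hUv' G G.2⟩ = Us' (potential G))
    (h₀ : Lp ℝ 2 (cellMeasure L)) (h₁ : Lp ℝ³ 2 (cellMeasure L)) :
    ((neumannGrad L (Us h₀) (Uv h₁) : gradSpace L) : Lp ℝ³ 2 (cellMeasure L)) =
      Uv (neumannGrad L h₀ h₁) := by
  set G := neumannGrad L h₀ h₁ with hGdef
  have hmem : Uv (G : Lp ℝ³ 2 (cellMeasure L)) ∈ gradSpace L := hUv _ G.2
  suffices h : (⟨Uv (G : Lp ℝ³ 2 (cellMeasure L)), hmem⟩ : gradSpace L) = neumannGrad L (Us h₀) (Uv h₁) by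
    rw [← h]
  refine eq_neumannGrad_of_forall_inner _ _ fun q hq => ?_
  set Ψ : gradSpace L := ⟨toCell L (cylGrad q), gradRange_le_gradSpace (toCell_cylGrad_mem_gradRange hq)⟩
    with hΨ
  show ⟪Uv (G : Lp ℝ³ 2 (cellMeasure L)), (Ψ : Lp ℝ³ 2 (cellMeasure L))⟫ =
    neumannFunctional L (Us h₀) (Uv h₁) Ψ
  rw [hadjv, neumannFunctional_apply]
  have h := inner_neumannGrad h₀ h₁ ⟨Uv' Ψ, hUv' _ Ψ.2⟩
  rw [Submodule.coe_inner] at h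
  simp only at h
  rw [← hGdef] at h
  rw [h, hpot' Ψ, ← hadjs, ← hadjv]

/-- **The weak Neumann problem is covariant under the periodic axial shift**:
`∇q[h₀(· + a e_z), h₁(· + a e_z)] = (∇q[h₀, h₁])(· + a e_z)`. [folklore] -/
theorem coe_neumannGrad_axialShiftLp (hL : 0 < L) (a : ℝ) (h₀ : Lp ℝ 2 (cellMeasure L))
    (h₁ : Lp ℝ³ 2 (cellMeasure L)) :
    ((neumannGrad L (axialShiftLp L a h₀) (axialShiftLp L a h₁) : gradSpace L) : Lp ℝ³ 2 (cellMeasure L)) =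
      axialShiftLp L a (neumannGrad L h₀ h₁ : Lp ℝ³ 2 (cellMeasure L)) :=
  coe_neumannGrad_map_eq (Us := (axialShiftLp L a).toContinuousLinearMap)
    (Us' := (axialShiftLp L (-a)).toContinuousLinearMap) (Uv := (axialShiftLp L a).toContinuousLinearMap)
    (Uv' := (axialShiftLp L (-a)).toContinuousLinearMap)
    (fun f g => inner_axialShiftLp_left hL a f g) (fun f g => inner_axialShiftLp_left hL a f g)
    (fun _ hG => axialShiftLp_mem_gradSpace hL a hG) (fun _ hG => axialShiftLp_mem_gradSpace hL (-a) hG)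
    (fun G => potential_axialShiftLp hL (-a) G) h₀ h₁

/-- **The weak Neumann problem is covariant under the rotations about the axis**:
`∇q[h₀ ∘ R_θ, R_{−θ} h₁ ∘ R_θ] = R_{−θ} (∇q[h₀, h₁]) ∘ R_θ`. [folklore] -/
theorem coe_neumannGrad_rotFieldLp (hL : 0 < L) (θ : ℝ) (h₀ : Lp ℝ 2 (cellMeasure L))
    (h₁ : Lp ℝ³ 2 (cellMeasure L)) :
    ((neumannGrad L (rotLp L θ h₀) (rotFieldLp L θ h₁) : gradSpace L) : Lp ℝ³ 2 (cellMeasure L)) =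
      rotFieldLp L θ (neumannGrad L h₀ h₁ : Lp ℝ³ 2 (cellMeasure L)) :=
  coe_neumannGrad_map_eq (Us := (rotLp L θ).toContinuousLinearMap)
    (Us' := (rotLp L (-θ)).toContinuousLinearMap) (Uv := (rotFieldLp L θ).toContinuousLinearMap)
    (Uv' := (rotFieldLp L (-θ)).toContinuousLinearMap)
    (fun f g => inner_rotFieldLp_left θ f g) (fun f g => inner_rotLp_left θ f g)
    (fun _ hG => rotFieldLp_mem_gradSpace θ hG) (fun _ hG => rotFieldLp_mem_gradSpace (-θ) hG)
    (fun G => potential_rotFieldLp hL (-θ) G) h₀ h₁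

/-- **Covariance of the Helmholtz projection under the shift**: `Q(U_a h) = U_a (Q h)`. [folklore] -/
theorem helmholtzProj_axialShiftLp (hL : 0 < L) (a : ℝ) (h : Lp ℝ³ 2 (cellMeasure L)) :
    helmholtzProj L (axialShiftLp L a h) = axialShiftLp L a (helmholtzProj L h) := by
  have h1 := coe_neumannGrad_axialShiftLp hL a 0 h
  rw [map_zero, coe_neumannGrad_zero_left, coe_neumannGrad_zero_left] at h1
  exact h1

/-- **Covariance of the Helmholtz projection under the rotations**: `Q(R_θ h) = R_θ (Q h)`. [folklore] -/
theorem helmholtzProj_rotFieldLp (hL : 0 < L) (θ : ℝ) (h : Lp ℝ³ 2 (cellMeasure L)) :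
    helmholtzProj L (rotFieldLp L θ h) = rotFieldLp L θ (helmholtzProj L h) := by
  have h1 := coe_neumannGrad_rotFieldLp hL θ 0 h
  rw [map_zero, coe_neumannGrad_zero_left, coe_neumannGrad_zero_left] at h1
  exact h1

/-- **Covariance of the Leray projection under the shift**: `P(U_a h) = U_a (P h)`. [folklore] -/
theorem lerayProj_axialShiftLp (hL : 0 < L) (a : ℝ) (h : Lp ℝ³ 2 (cellMeasure L)) :
    lerayProj L (axialShiftLp L a h) = axialShiftLp L a (lerayProj L h) := by
  have h1 := lerayProj_add_helmholtzProj (L := L) (axialShiftLp L a h)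
  have h2 := lerayProj_add_helmholtzProj (L := L) h
  rw [helmholtzProj_axialShiftLp hL] at h1
  have h3 : axialShiftLp L a (lerayProj L h) + axialShiftLp L a (helmholtzProj L h) = axialShiftLp L a h := by
    rw [← map_add, h2]
  exact add_right_cancel (h1.trans h3.symm)

/-- **Covariance of the Leray projection under the rotations**: `P(R_θ h) = R_θ (P h)`. [folklore] -/
theorem lerayProj_rotFieldLp (hL : 0 < L) (θ : ℝ) (h : Lp ℝ³ 2 (cellMeasure L)) :
    lerayProj L (rotFieldLp L θ h) = rotFieldLp L θ (lerayProj L h) := by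
  have h1 := lerayProj_add_helmholtzProj (L := L) (rotFieldLp L θ h)
  have h2 := lerayProj_add_helmholtzProj (L := L) h
  rw [helmholtzProj_rotFieldLp hL] at h1
  have h3 : rotFieldLp L θ (lerayProj L h) + rotFieldLp L θ (helmholtzProj L h) = rotFieldLp L θ h := by
    rw [← map_add, h2]
  exact add_right_cancel (h1.trans h3.symm)

end PeriodicCylinder

end Literature.Analysis.FluidPDE
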